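import Literature.AlgebraicGeometry.Deformation.ObstructionCocycle
import Literature.AlgebraicGeometry.Deformation.DefectCochainReframe
import Literature.AlgebraicGeometry.Deformation.FrameCoverRestrictAlong
import HarnessLib

/-!
# Two framed lifting data of the same module have cohomologous obstruction cocycles on the common cover

Setting of `Deformation/DefectCochain.lean`: `j : Y ⟶ Z₀`, `i : Z₀ ⟶ Z₁` a first-order thickening,
`eI : i_* j_* 𝒪_Y ≅ 𝓘`, an `𝒪_{Z₀}`-module `F`, `E = j^*F`. Let `(C₁, L₁)` and `(C₂, L₂)` be TWO data
for `F` — frame covers over opens `U¹_a` (`a ∈ ι₁`), `U²_b` (`b ∈ ι₂`) of `Z₁` with lifted transition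
matrices — and `ω₁`, `ω₂` the families of local endomorphisms of their defect cochains (Čech
`2`-cocycles of `𝓔nd(E)` on `𝓤¹_Y`, `𝓤²_Y`; `Modules/CechEndCochainFamily.lean`). On the common
refinement `W_{(a,b)} = U¹_a ∩ U²_b`, indexed by `ι₁ × ι₂` with the two projections:

* restricting `(C₁, L₁)` along `pr₁` and `(C₂, L₂)` along `pr₂` gives two data on the SAME cover
  (`Deformation/FrameCoverRestrictAlong.lean`), whose cocycles are `ω₁|_{pr₁}`, `ω₂|_{pr₂}`
  (`Cech.restrictFamilyAlong`, `Modules/CechRefineAlong.lean`);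
* the second is a reframing of the first (`e²_b|` versus `e¹_a|` over `W_{(a,b)}`); when the
  `W_{(a,b)}` are affine there are mutually inverse lifted frame changes
  (`nonempty_liftedFrameChange`), the transformed lifts have THE SAME cocycle
  (`Deformation/DefectCochainReframe.lean`), and two systems of lifts of one frame cover have
  cocycles differing by a Čech coboundary (`Deformation/ObstructionCocycle.lean`).

Hence **`ω₂|_{pr₂} - ω₁|_{pr₁} = dβ`** for a `1`-cochain `β` of local endomorphisms on the common
cover (`exists_restrictFamilyAlong_sub_eq_dFamily`). With the invariance of Čech classes under
refinement along index maps (`Cech.classOf_exactAugmentation_restrictFamilyAlong`) this is the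
independence of the obstruction class `[ω] ∈ Ext²(E, E)` of all choices (Hartshorne, *Deformation
Theory*, proof of Thm. 7.1). Everything is proved; no named facts.

## References

* R. Hartshorne, *Deformation Theory*, GTM 257 (2010), §7, proof of Thm. 7.1. [Hartshorne2010]
* R. Hartshorne, *Algebraic Geometry*, GTM 52 (1977), III.4, Lemma 4.4 and Ex. 4.4. [Hartshorne1977]
-/

noncomputable section

open CategoryTheory AlgebraicGeometry Opposite TopologicalSpace Limits

namespace Literature.AlgebraicGeometry.Deformation

open Literature.AlgebraicGeometry.Modules Literature.AlgebraicGeometry.Motives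

universe u

variable {Y Z₀ Z₁ : Scheme.{u}} {j : Y ⟶ Z₀} {i : Z₀ ⟶ Z₁} {F : Z₀.Modules} {ι₁ ι₂ : Type u}

namespace FrameCover

variable (C₁ : FrameCover i F ι₁) (C₂ : FrameCover i F ι₂)

/-! ### The common refinement of two frame covers -/

/-- The opens `W_{(a,b)} = U¹_a ∩ U²_b` of the common refinement. [cite: Hartshorne1977, III.4] -/
abbrev commonOpen (p : ι₁ × ι₂) : Z₁.Opens := C₁.U p.1 ⊓ C₂.U p.2

/-- `W_{(a,b)} ≤ U¹_a`. [folklore] -/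
lemma commonOpen_le₁ (p : ι₁ × ι₂) : commonOpen C₁ C₂ p ≤ C₁.U p.1 := inf_le_left

/-- `W_{(a,b)} ≤ U²_b`. [folklore] -/
lemma commonOpen_le₂ (p : ι₁ × ι₂) : commonOpen C₁ C₂ p ≤ C₂.U p.2 := inf_le_right

/-- The common refinement covers `Z₁` when both covers do. [folklore] -/
lemma exists_mem_commonOpen (h₁ : ∀ z : Z₁, ∃ a, z ∈ C₁.U a) (h₂ : ∀ z : Z₁, ∃ b, z ∈ C₂.U b) (z : Z₁) :
    ∃ p, z ∈ commonOpen C₁ C₂ p := by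
  obtain ⟨a, ha⟩ := h₁ z
  obtain ⟨b, hb⟩ := h₂ z
  exact ⟨(a, b), ha, hb⟩

/-- **The first datum restricted to the common refinement** (frames `e¹_a|_{i⁻¹W_{(a,b)}}`). [folklore] -/
abbrev common₁ : FrameCover i F (ι₁ × ι₂) :=
  C₁.restrictAlong (@Prod.fst ι₁ ι₂) (commonOpen C₁ C₂) (commonOpen_le₁ C₁ C₂)

/-- **The second datum restricted to the common refinement** (frames `e²_b|_{i⁻¹W_{(a,b)}}`). [folklore] -/
abbrev common₂ : FrameCover i F (ι₁ × ι₂) :=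
  C₂.restrictAlong (@Prod.snd ι₁ ι₂) (commonOpen C₁ C₂) (commonOpen_le₂ C₁ C₂)

/-- The second restricted cover IS the first one reframed by the frames of the second (definitional).
[folklore] -/
lemma common₂_eq_reframe : common₂ C₁ C₂ = (common₁ C₁ C₂).reframe (common₂ C₁ C₂).e := rfl

namespace Lifts

variable {C₁ C₂} (L₁ : C₁.Lifts) (L₂ : C₂.Lifts)
  (eI : (Scheme.Modules.pushforward i).obj ((Scheme.Modules.pushforward j).obj (unitModule Y)) ≅
    idealModule i)
  [IsFirstOrderThickening i]

/-- **On the common refinement the two obstruction cocycles differ by a Čech coboundary**, given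
mutually inverse lifted frame changes between the two restricted frame systems.
[cite: Hartshorne2010, §7 (proof of Thm. 7.1)] -/
theorem restrictFamilyAlong_sub_eq_dFamily (Φ : (common₁ C₁ C₂).LiftedFrameChange (common₂ C₁ C₂).e) :
    Cech.restrictFamilyAlong (@Prod.snd ι₁ ι₂) (baseOpen_restrictAlong_le (@Prod.snd ι₁ ι₂) (commonOpen C₁ C₂) (commonOpen_le₂ C₁ C₂))
        ((C₂.baseFraming j).toLocalFamily (L₂.defectCochain eI)) -
      Cech.restrictFamilyAlong (@Prod.fst ι₁ ι₂) (baseOpen_restrictAlong_le (@Prod.fst ι₁ ι₂) (commonOpen C₁ C₂) (commonOpen_le₁ C₁ C₂))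
        ((C₁.baseFraming j).toLocalFamily (L₁.defectCochain eI)) =
      Cech.dFamily (((common₂ C₁ C₂).baseFraming j).toLocalFamily
        (diffCochain eI ((L₁.restrictAlong (@Prod.fst ι₁ ι₂) (commonOpen C₁ C₂) (commonOpen_le₁ C₁ C₂)).reframe Φ)
          (L₂.restrictAlong (@Prod.snd ι₁ ι₂) (commonOpen C₁ C₂) (commonOpen_le₂ C₁ C₂)))) := by
  rw [← L₂.toLocalFamily_defectCochain_restrictAlong, ← L₁.toLocalFamily_defectCochain_restrictAlong,
    ← (L₁.restrictAlong (@Prod.fst ι₁ ι₂) (commonOpen C₁ C₂) (commonOpen_le₁ C₁ C₂)).toLocalFamily_defectCochain_reframe Φ eI,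
    Framing.dFamily_toLocalFamily_one, ← defectCochain_sub, Framing.toLocalFamily_sub]

/-- **Two framed lifting data of the same module have cohomologous obstruction cocycles on the
common refinement `W_{(a,b)} = U¹_a ∩ U²_b`**, as soon as these opens are affine (e.g. `Z₁`
separated and all `U¹_a`, `U²_b` affine): `ω₂|_{pr₂} - ω₁|_{pr₁} = dβ`.
[cite: Hartshorne2010, §7 (proof of Thm. 7.1)] [cite: Hartshorne1977, III Lemma 4.4] -/
theorem exists_restrictFamilyAlong_sub_eq_dFamily (hW : ∀ p : ι₁ × ι₂, IsAffineOpen (C₁.U p.1 ⊓ C₂.U p.2)) :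
    ∃ β : Cech.LocalFamily (fun p : ι₁ × ι₂ => baseOpen j i (C₁.U p.1 ⊓ C₂.U p.2)) 1
        ((Scheme.Modules.pullback j).obj F) ((Scheme.Modules.pullback j).obj F),
      Cech.restrictFamilyAlong (@Prod.snd ι₁ ι₂)
          (baseOpen_restrictAlong_le (@Prod.snd ι₁ ι₂) (commonOpen C₁ C₂) (commonOpen_le₂ C₁ C₂))
          ((C₂.baseFraming j).toLocalFamily (L₂.defectCochain eI)) -
        Cech.restrictFamilyAlong (@Prod.fst ι₁ ι₂)
          (baseOpen_restrictAlong_le (@Prod.fst ι₁ ι₂) (commonOpen C₁ C₂) (commonOpen_le₁ C₁ C₂))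
          ((C₁.baseFraming j).toLocalFamily (L₁.defectCochain eI)) =
        Cech.dFamily β := by
  obtain ⟨Φ⟩ := (common₁ C₁ C₂).nonempty_liftedFrameChange (common₂ C₁ C₂).e hW
  exact ⟨_, restrictFamilyAlong_sub_eq_dFamily L₁ L₂ eI Φ⟩

end Lifts

end FrameCover

end Literature.AlgebraicGeometry.Deformation

end
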